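import Literature.Algebra.Homology.NatCochainSixTerm
import HarnessLib

/-!
# The dimension count of a flag: `h⁰ ≠ 0` from `n` commuting regular twists and a skyscraper base

J.-P. Serre, *Faisceaux algébriques cohérents* (1955), n° 66 Thm. 2 with n° 81 Prop. 6, and
*Géométrie algébrique et géométrie analytique* (1956), n° 16 Lemme 8; D. Mumford, *Abelian
Varieties* (1970), §16 ("the Riemann–Roch theorem" by induction over hyperplane sections): for a
coherent sheaf `𝓕` on a projective `n`-fold and `n` hyperplane sections `t₀ = 0, …, t_{n-1} = 0`
in general position (a regular sequence on `𝓕`, meeting in a finite non-empty set `Z`), the exact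
sequences `0 → 𝓕_i(m) →^{t_i} 𝓕_i(m+1) → 𝓕_{i+1}(m+1) → 0` (`𝓕_i` the restriction of `𝓕` to
`{t₀ = ⋯ = t_{i-1} = 0}`, `𝓕_n = 𝓕_Z` a non-zero skyscraper) give, by the six-term dimension
inequalities alone (no vanishing theorem, no duality), that `h⁰(𝓕(m)) → ∞`.

This file is the ABSTRACT form of that count for a **flag tower** of cochain complexes of vector
spaces (`NatCochain.FlagTower n`), the `n`-twist generalisation of the pencil tower
`NatCochain.PencilTower` (file `NatCochainPencilCount`, the case `n = 2`): complexes `F(m)`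
(`m ∈ ℕ`; in the application the Čech complexes `C•(𝔙, 𝒪(L ⊗ 𝒪(mH)))` of ONE framed cover of a
compact complex `n`-fold) with

* `n` pairwise commuting cochain maps `t_j,m : F(m) → F(m+1)` (`j < n`; multiplication by the
  `n` sections `s_j` of `𝒪(H)` of a transverse flag, cf.
  `Literature.AlgebraicGeometry.HodgeTheory.exists_transverse_flag`),
* which form a REGULAR SEQUENCE on the cochains of positive twist: for every `i < n` and
  `x ∈ F(m+1)`, `t_i x ∈ Σ_{j<i} t_j F(m+1) ⟹ x ∈ Σ_{j<i} t_j F(m)` (for `i = 0`: `t₀` is injective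
  on `F(m+1)`),
* surjective cochain maps `ev_m : F(m+1) → Z(m)` onto complexes `Z(m)` (the skyscraper complexes at
  the finite transversal intersection) with `ker ev_m = Σ_{j<n} t_j F(m)` degreewise.

The levels of the tower are the quotient complexes `G_i(m) = F(m+1) ⧸ Σ_{j<i} t_j F(m)`
(`FlagTower.flag`, `FlagTower.G`, `FlagTower.dG`; level `0` is `F(m+1)` — `cohomologyFEquiv` —
and level `n` is canonically `Z(m)` — `toBase_bijective`, `cohomologyZEquiv`); multiplication by `t_i`
descends to INJECTIVE cochain maps `T_i : G_i(m) → G_i(m+1)` (`injective_T`, the regularity) whose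
cokernel is `G_{i+1}(m+1)` (`exact_T_π`), whence the short exact sequences of complexes
`FlagTower.ses i m : 0 → G_i(m) → G_i(m+1) → G_{i+1}(m+1) → 0` for all `i < n`, `m ≥ 0`.
Finiteness of every `H^k(F(m))` and of `H⁰(Z(m)), H¹(Z(m))` propagates to `H⁰, H¹` of every level
(`finite_of_le` in the region `m ≥ i` by the cokernel terms, `finite_deg_le_one` everywhere by the
kernel terms, an induction on the level and on the distance to that region), and the tower count
`exists_pos_h0_of_euler_inequalities` (file `EulerInequalityGrowth`) fed with the six-term
inequalities (`ShortExactSeq.finrank_six_term_le`, file `NatCochainSixTerm`) yields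

* `FlagTower.exists_pos_finrank_cohomology_zero`: if all `H^k(F(m))` and `H⁰(Z(m)), H¹(Z(m))` are
  finite-dimensional and `h¹(Z(m)) < h⁰(Z(m))` for all `m`, then `h⁰(F(m)) > 0` for some `m ≥ 1`;
* `FlagTower.exists_lt_finrank_cohomology_zero`: for `n ≥ 1`, `h⁰(F(m))` (`m ≥ 1`) is even unbounded.

Everything is proved; pure linear algebra (no sheaves, no geometry). The geometric inputs of the
application in dimension `n` — the regular-sequence property of a transverse flag of sections on
chart-convex sets, `ker ev = (t₀, …, t_{n-1})` (local Nullstellensatz) and the surjectivity of `ev`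
(interpolation at a finite set), `h¹(Z) = 0 < h⁰(Z)` and the Cartan–Serre finiteness of
`H^k(F(m))` in every degree — are exactly the fields / hypotheses; `FlagTower.mem_flag_iff` spells
the flag submodules `Σ_{j<i} t_j F(m)` as finite sums. Consumer: the dimension count of Serre's
theorem A for holomorphic line cocycles on a smooth projective variety of ARBITRARY dimension
(the Kodaira–Serre sections `Literature.AlgebraicGeometry.HodgeTheory.kodairaSerre_exists_globalSection_algebraicTwist`,
hence Lefschetz `(1,1)` in all dimensions).

## References

* J.-P. Serre, *Faisceaux algébriques cohérents*, Ann. of Math. 61 (1955), n° 66, n° 81.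
  [SerreFAC1955]
* J.-P. Serre, *Géométrie algébrique et géométrie analytique*, Ann. Inst. Fourier 6 (1956), n° 16
  Lemme 8. [SerreGAGA1956]
* D. Mumford, *Abelian Varieties* (1970), §16. [MumfordAV1970]
* C. A. Weibel, *An Introduction to Homological Algebra* (1994), Thm. 1.3.1. [Weibel1994]
-/

namespace Literature.Algebra.Homology

universe u w w'

open Function Module

namespace NatCochain

variable {K : Type u} [Field K]
  {F : ℕ → ℕ → Type w} [∀ m k, AddCommGroup (F m k)] [∀ m k, Module K (F m k)]
  {Z : ℕ → ℕ → Type w'} [∀ m k, AddCommGroup (Z m k)] [∀ m k, Module K (Z m k)]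

/-! ### Finiteness of the middle term of an exact triple -/

omit [∀ m k, AddCommGroup (F m k)] [∀ m k, Module K (F m k)]
  [∀ m k, AddCommGroup (Z m k)] [∀ m k, Module K (Z m k)] in
/-- The middle term of an exact `A → B → C` of vector spaces with finite-dimensional outer terms is
finite-dimensional (range-restricted form of `Module.Finite.of_exact`). [folklore] -/
private theorem finiteDimensional_mid_of_exact {A B C : Type*} [AddCommGroup A] [Module K A]
    [AddCommGroup B] [Module K B] [AddCommGroup C] [Module K C]
    [FiniteDimensional K A] [FiniteDimensional K C] (f : A →ₗ[K] B) (g : B →ₗ[K] C)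
    (h : Exact f g) : FiniteDimensional K B := by
  have h' : Exact f g.rangeRestrict := by
    intro b
    rw [← h b, ← LinearMap.mem_ker, ← LinearMap.mem_ker, LinearMap.ker_rangeRestrict]
  exact Module.Finite.of_exact h' g.surjective_rangeRestrict

/-! ### Flag towers -/

/-- **A flag tower of cochain complexes** with `n` twists over the complexes `(F(m), d_m)` with
base complexes `(Z(m), dZ_m)`: `n` pairwise commuting cochain maps `t_j,m : F(m) → F(m+1)` which
form a regular sequence on the cochains of positive twist (`t_i x ∈ Σ_{j<i} im t_j ⟹ x ∈ Σ_{j<i} im t_j`,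
for `x ∈ F(m+1)`), and surjective cochain maps `ev_m : F(m+1) → Z(m)` with
`ker ev_m = Σ_{j<n} im t_j,m` — the shape of the Čech complexes of `𝓕(m) = 𝓕 ⊗ 𝒪(mH)` on a
projective `n`-fold with the multiplications by `n` sections of `𝒪(H)` in general position and the
restriction to their finite common zero set (Serre's Lemme 8 in dimension `n`). The case `n = 2` is
`NatCochain.PencilTower`. [cite: SerreGAGA1956, n° 16 Lemme 8] [cite: SerreFAC1955, n° 81] -/
structure FlagTower (n : ℕ) (d : ∀ m k, F m k →ₗ[K] F m (k + 1))
    (dZ : ∀ m k, Z m k →ₗ[K] Z m (k + 1)) where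
  /-- multiplication by the `j`-th section, `t_j,m : F(m) → F(m+1)` -/
  t : Fin n → ∀ m k, F m k →ₗ[K] F (m + 1) k
  /-- restriction to the common zero set, `ev_m : F(m+1) → Z(m)` -/
  ev : ∀ m k, F (m + 1) k →ₗ[K] Z m k
  /-- each `F(m)` is a complex -/
  d_d : ∀ m k (x : F m k), d m (k + 1) (d m k x) = 0
  /-- each `t_j` is a cochain map -/
  comm_t : ∀ j m k (x : F m k), t j m (k + 1) (d m k x) = d (m + 1) k (t j m k x)
  /-- the twists commute: `t_i,m+1 t_j,m = t_j,m+1 t_i,m` -/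
  t_comm : ∀ i j m k (x : F m k), t i (m + 1) k (t j m k x) = t j (m + 1) k (t i m k x)
  /-- regularity: `t_i` is a non-zero-divisor modulo `(t_0, …, t_{i-1})` on `F(m+1)` -/
  regular : ∀ (i : Fin n) m k (x : F (m + 1) k),
    t i (m + 1) k x ∈ (⨆ (j : Fin n) (_ : (j : ℕ) < i), LinearMap.range (t j (m + 1) k)) →
      x ∈ ⨆ (j : Fin n) (_ : (j : ℕ) < i), LinearMap.range (t j m k)
  /-- `ev` is a cochain map -/
  comm_ev : ∀ m k (x : F (m + 1) k), ev m (k + 1) (d (m + 1) k x) = dZ m k (ev m k x)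
  /-- `ev` is surjective in every degree -/
  surjective_ev : ∀ m k, Surjective (ev m k)
  /-- `ker ev_m = Σ_j im t_j,m` in every degree -/
  ker_ev : ∀ m k, LinearMap.ker (ev m k) = ⨆ j : Fin n, LinearMap.range (t j m k)

namespace FlagTower

variable {n : ℕ} {d : ∀ m k, F m k →ₗ[K] F m (k + 1)} {dZ : ∀ m k, Z m k →ₗ[K] Z m (k + 1)}
  (P : FlagTower n d dZ)

/-! ### The flag submodules `Σ_{j<i} t_j F(m) ⊆ F(m+1)` -/

/-- **The `i`-th flag submodule** `Σ_{j<i} t_j,m F(m)ᵏ ⊆ F(m+1)ᵏ` (the "ideal generated by the first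
`i` sections" on cochains). [cite: SerreFAC1955, n° 81] -/
def flag (i m k : ℕ) : Submodule K (F (m + 1) k) :=
  ⨆ (j : Fin n) (_ : (j : ℕ) < i), LinearMap.range (P.t j m k)

/-- `im t_j ⊆ Σ_{j'<i} im t_j'` for `j < i`. [folklore] -/
theorem range_le_flag {i m k : ℕ} (j : Fin n) (hj : (j : ℕ) < i) :
    LinearMap.range (P.t j m k) ≤ P.flag i m k :=
  fun _ hx ↦ Submodule.mem_iSup_of_mem j (Submodule.mem_iSup_of_mem hj hx)

/-- The `0`-th flag submodule is `0`. [folklore] -/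
theorem flag_zero (m k : ℕ) : P.flag 0 m k = ⊥ :=
  le_bot_iff.1 (iSup₂_le fun _ hj ↦ absurd hj (Nat.not_lt_zero _))

/-- The flag submodules increase with `i`. [folklore] -/
theorem flag_mono {i i' : ℕ} (h : i ≤ i') (m k : ℕ) : P.flag i m k ≤ P.flag i' m k :=
  iSup₂_le fun j hj ↦ P.range_le_flag j (lt_of_lt_of_le hj h)

/-- `Σ_{j<i+1} im t_j = Σ_{j<i} im t_j + im t_i`. [folklore] -/
theorem flag_succ (i : ℕ) (hi : i < n) (m k : ℕ) :
    P.flag (i + 1) m k = P.flag i m k ⊔ LinearMap.range (P.t ⟨i, hi⟩ m k) := by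
  refine le_antisymm (iSup₂_le fun j hj ↦ ?_)
    (sup_le (P.flag_mono (Nat.le_succ i) m k) (P.range_le_flag ⟨i, hi⟩ (Nat.lt_succ_self i)))
  rcases (Nat.lt_succ_iff.1 hj).lt_or_eq with hj | hj
  · exact (P.range_le_flag j hj).trans le_sup_left
  · have : j = ⟨i, hi⟩ := Fin.ext hj
    subst this
    exact le_sup_right

/-- From `i = n` on, the flag submodule is `Σ_j im t_j`. [folklore] -/
theorem flag_of_le {i : ℕ} (h : n ≤ i) (m k : ℕ) :
    P.flag i m k = ⨆ j : Fin n, LinearMap.range (P.t j m k) :=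
  le_antisymm (iSup₂_le fun j _ ↦ le_iSup (fun j : Fin n ↦ LinearMap.range (P.t j m k)) j)
    (iSup_le fun j ↦ P.range_le_flag j (lt_of_lt_of_le j.isLt h))

/-- The `n`-th flag submodule is the kernel of `ev`. [cite: SerreGAGA1956, n° 16 Lemme 8] -/
theorem flag_eq_ker_ev (m k : ℕ) : P.flag n m k = LinearMap.ker (P.ev m k) := by
  rw [P.ker_ev, P.flag_of_le le_rfl]

/-- **The flag submodules as finite sums**: the linear map `a ↦ Σ_{j<i} t_j (a j)`. [folklore] -/
def flagSum (i m k : ℕ) : (Fin n → F m k) →ₗ[K] F (m + 1) k :=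
  ∑ j ∈ (Finset.univ : Finset (Fin n)).filter (fun j : Fin n ↦ j.val < i), P.t j m k ∘ₗ LinearMap.proj j

/-- `flagSum` on elements. [folklore] -/
theorem flagSum_apply (i m k : ℕ) (a : Fin n → F m k) :
    P.flagSum i m k a = ∑ j ∈ (Finset.univ : Finset (Fin n)).filter (fun j : Fin n ↦ j.val < i),
      P.t j m k (a j) := by
  simp [flagSum]

/-- The `i`-th flag submodule is the range of `flagSum i`. [folklore] -/
theorem flag_eq_range_flagSum (i m k : ℕ) : P.flag i m k = LinearMap.range (P.flagSum i m k) := by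
  classical
  apply le_antisymm
  · refine iSup₂_le fun j hj ↦ ?_
    rintro _ ⟨y, rfl⟩
    refine ⟨Pi.single j y, ?_⟩
    rw [flagSum_apply, Finset.sum_eq_single j]
    · rw [Pi.single_eq_same]
    · intro j' _ hj'
      rw [Pi.single_eq_of_ne hj', map_zero]
    · intro hj'
      exact (hj' (Finset.mem_filter.2 ⟨Finset.mem_univ j, hj⟩)).elim
  · rintro _ ⟨a, rfl⟩
    rw [flagSum_apply]
    exact Submodule.sum_mem _ fun j hj ↦ P.range_le_flag j (Finset.mem_filter.1 hj).2 ⟨a j, rfl⟩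

/-- **Membership in the flag submodule**: `x ∈ Σ_{j<i} t_j F(m)` iff `x = Σ_{j<i} t_j a_j` for some
cochains `a_j ∈ F(m)` (the form in which regularity and `ker ev` are verified in the application).
[folklore] -/
theorem mem_flag_iff {i m k : ℕ} {x : F (m + 1) k} :
    x ∈ P.flag i m k ↔ ∃ a : Fin n → F m k,
      ∑ j ∈ (Finset.univ : Finset (Fin n)).filter (fun j : Fin n ↦ j.val < i), P.t j m k (a j) = x := by
  rw [flag_eq_range_flagSum, LinearMap.mem_range]
  simp only [flagSum_apply]

/-- Regularity in terms of `flag`: `t_i x ∈ flag i (m+1) ⟹ x ∈ flag i m` for `x ∈ F(m+1)`.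
[cite: SerreFAC1955, n° 81] -/
theorem regular_flag (i : Fin n) (m k : ℕ) (x : F (m + 1) k)
    (hx : P.t i (m + 1) k x ∈ P.flag i (m + 1) k) : x ∈ P.flag i m k :=
  P.regular i m k x hx

/-- The differential preserves the flag submodules (the `t_j` are cochain maps). [folklore] -/
theorem flag_le_comap_d (i m k : ℕ) :
    P.flag i m k ≤ (P.flag i m (k + 1)).comap (d (m + 1) k) := by
  refine iSup₂_le fun j hj ↦ ?_
  rintro _ ⟨y, rfl⟩
  show d (m + 1) k (P.t j m k y) ∈ P.flag i m (k + 1)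
  rw [← P.comm_t]
  exact P.range_le_flag j hj ⟨d m k y, rfl⟩

/-- The twists preserve the flag submodules (the `t_j` commute). [folklore] -/
theorem flag_le_comap_t (i : ℕ) (j : Fin n) (m k : ℕ) :
    P.flag i m k ≤ (P.flag i (m + 1) k).comap (P.t j (m + 1) k) := by
  refine iSup₂_le fun j' hj' ↦ ?_
  rintro _ ⟨y, rfl⟩
  show P.t j (m + 1) k (P.t j' m k y) ∈ P.flag i (m + 1) k
  rw [P.t_comm]
  exact P.range_le_flag j' hj' ⟨P.t j m k y, rfl⟩

/-! ### The levels `G_i(m) = F(m+1) ⧸ Σ_{j<i} t_j F(m)` -/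

/-- **Level `i`, column `m`** of the tower: `G_i(m)ᵏ = F(m+1)ᵏ ⧸ Σ_{j<i} t_j F(m)ᵏ` (the Čech
cochains of `𝓕(m+1)` restricted to `{t₀ = ⋯ = t_{i-1} = 0}`). [cite: SerreGAGA1956, n° 16 Lemme 8] -/
abbrev G (i m k : ℕ) : Type w :=
  F (m + 1) k ⧸ P.flag i m k

/-- The differential of level `i`. [cite: Weibel1994, Ex. 1.1.1] -/
def dG (i m : ℕ) (k : ℕ) : P.G i m k →ₗ[K] P.G i m (k + 1) :=
  Submodule.mapQ _ _ (d (m + 1) k) (P.flag_le_comap_d i m k)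

/-- The differential of a level on classes. [folklore] -/
@[simp]
theorem dG_mk (i m k : ℕ) (x : F (m + 1) k) :
    P.dG i m k (Submodule.Quotient.mk x) = Submodule.Quotient.mk (d (m + 1) k x) :=
  rfl

/-- Each level is a complex. [folklore] -/
theorem dG_dG (i m k : ℕ) (c : P.G i m k) : P.dG i m (k + 1) (P.dG i m k c) = 0 := by
  obtain ⟨x, rfl⟩ := Submodule.Quotient.mk_surjective _ c
  rw [dG_mk, dG_mk, P.d_d, Submodule.Quotient.mk_zero]

/-! ### Multiplication by `t_i` on level `i` and the projection to level `i+1` -/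

/-- **`T_i : G_i(m) → G_i(m+1)`**, the map induced by `t_i,m+1` (`[x] ↦ [t_i x]`).
[cite: SerreGAGA1956, n° 16 Lemme 8] -/
def T (i : ℕ) (hi : i < n) (m k : ℕ) : P.G i m k →ₗ[K] P.G i (m + 1) k :=
  Submodule.mapQ _ _ (P.t ⟨i, hi⟩ (m + 1) k) (P.flag_le_comap_t i ⟨i, hi⟩ m k)

/-- `T_i` on classes. [folklore] -/
@[simp]
theorem T_mk (i : ℕ) (hi : i < n) (m k : ℕ) (x : F (m + 1) k) :
    P.T i hi m k (Submodule.Quotient.mk x) = Submodule.Quotient.mk (P.t ⟨i, hi⟩ (m + 1) k x) :=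
  rfl

/-- `T_i` is a cochain map. [folklore] -/
theorem T_comm (i : ℕ) (hi : i < n) (m k : ℕ) (c : P.G i m k) :
    P.T i hi m (k + 1) (P.dG i m k c) = P.dG i (m + 1) k (P.T i hi m k c) := by
  obtain ⟨x, rfl⟩ := Submodule.Quotient.mk_surjective _ c
  rw [dG_mk, T_mk, T_mk, dG_mk, P.comm_t]

/-- **`T_i` is injective** (`t_i` is a non-zero-divisor modulo `(t₀, …, t_{i-1})`).
[cite: SerreGAGA1956, n° 16 Lemme 8] [cite: SerreFAC1955, n° 81] -/
theorem injective_T (i : ℕ) (hi : i < n) (m k : ℕ) : Injective (P.T i hi m k) := by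
  rw [← LinearMap.ker_eq_bot, Submodule.eq_bot_iff]
  intro c hc
  obtain ⟨x, rfl⟩ := Submodule.Quotient.mk_surjective _ c
  rw [LinearMap.mem_ker, T_mk, Submodule.Quotient.mk_eq_zero] at hc
  exact (Submodule.Quotient.mk_eq_zero _).2 (P.regular ⟨i, hi⟩ m k x hc)

/-- **The projection `G_i(m) → G_{i+1}(m)`** (quotient by the larger flag submodule).
[cite: SerreGAGA1956, n° 16 Lemme 8] -/
def π (i m k : ℕ) : P.G i m k →ₗ[K] P.G (i + 1) m k :=
  Submodule.mapQ _ _ LinearMap.id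
    (by rw [Submodule.comap_id]; exact P.flag_mono (Nat.le_succ i) m k)

/-- The projection on classes. [folklore] -/
@[simp]
theorem π_mk (i m k : ℕ) (x : F (m + 1) k) :
    P.π i m k (Submodule.Quotient.mk x) = Submodule.Quotient.mk x :=
  rfl

/-- The projection is a cochain map. [folklore] -/
theorem π_comm (i m k : ℕ) (c : P.G i m k) :
    P.π i m (k + 1) (P.dG i m k c) = P.dG (i + 1) m k (P.π i m k c) := by
  obtain ⟨x, rfl⟩ := Submodule.Quotient.mk_surjective _ c
  rfl

/-- The projection is surjective. [folklore] -/
theorem surjective_π (i m k : ℕ) : Surjective (P.π i m k) := by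
  intro c
  obtain ⟨x, rfl⟩ := Submodule.Quotient.mk_surjective _ c
  exact ⟨Submodule.Quotient.mk x, rfl⟩

/-- **Exactness `im T_i = ker (G_i(m+1) → G_{i+1}(m+1))`**: the cokernel of `T_i` is the next level
(`Σ_{j<i+1} im t_j = Σ_{j<i} im t_j + im t_i`). [cite: SerreGAGA1956, n° 16 Lemme 8] -/
theorem exact_T_π (i : ℕ) (hi : i < n) (m k : ℕ) : Exact (P.T i hi m k) (P.π i (m + 1) k) := by
  intro c
  obtain ⟨x, rfl⟩ := Submodule.Quotient.mk_surjective _ c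
  rw [π_mk, Submodule.Quotient.mk_eq_zero, P.flag_succ i hi, Submodule.mem_sup]
  constructor
  · rintro ⟨y, hy, _, ⟨w, rfl⟩, rfl⟩
    refine ⟨Submodule.Quotient.mk w, ?_⟩
    rw [T_mk, Submodule.Quotient.eq]
    simpa using P.flag i (m + 1) k |>.neg_mem hy
  · rintro ⟨c', hc'⟩
    obtain ⟨w, rfl⟩ := Submodule.Quotient.mk_surjective _ c'
    rw [T_mk, Submodule.Quotient.eq] at hc'
    refine ⟨x - P.t ⟨i, hi⟩ (m + 1) k w, ?_, P.t ⟨i, hi⟩ (m + 1) k w, ⟨w, rfl⟩, by abel⟩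
    have h := (P.flag i (m + 1) k).neg_mem hc'
    rwa [neg_sub] at h

/-- **The short exact sequence of level `i`**:
`0 → G_i(m) →^{T_i} G_i(m+1) → G_{i+1}(m+1) → 0` for `i < n` and every `m`.
[cite: SerreGAGA1956, n° 16 Lemme 8] [cite: Weibel1994, Thm. 1.3.1] -/
def ses (i : ℕ) (hi : i < n) (m : ℕ) :
    ShortExactSeq (P.dG i m) (P.dG i (m + 1)) (P.dG (i + 1) (m + 1)) where
  f := P.T i hi m
  g := P.π i (m + 1)
  comm_f := P.T_comm i hi m
  comm_g := P.π_comm i (m + 1)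
  injective_f := P.injective_T i hi m
  exact_fg := P.exact_T_π i hi m
  surjective_g := P.surjective_π i (m + 1)
  dB_dB := P.dG_dG i (m + 1)

/-! ### Level `0` is `F(m+1)`, level `n` is `Z(m)` -/

/-- The quotient map `F(m+1) → G_0(m) = F(m+1) ⧸ 0`. [folklore] -/
def ofF (m k : ℕ) : F (m + 1) k →ₗ[K] P.G 0 m k :=
  (P.flag 0 m k).mkQ

/-- `ofF` is a cochain map. [folklore] -/
theorem ofF_comm (m k : ℕ) (x : F (m + 1) k) :
    P.ofF m (k + 1) (d (m + 1) k x) = P.dG 0 m k (P.ofF m k x) :=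
  rfl

/-- `ofF` is bijective (the `0`-th flag submodule vanishes). [folklore] -/
theorem ofF_bijective (m k : ℕ) : Bijective (P.ofF m k) :=
  ⟨LinearMap.ker_eq_bot.1 (by rw [ofF, Submodule.ker_mkQ, flag_zero]), Submodule.mkQ_surjective _⟩

/-- **`H^k(F(m+1)) ≃ H^k(G_0(m))`**: level `0` computes the cohomology of `F(m+1)`. [folklore] -/
noncomputable def cohomologyFEquiv (m k : ℕ) :
    Cohomology (d (m + 1)) k ≃ₗ[K] Cohomology (P.dG 0 m) k :=
  Cohomology.equivOfBijective (P.ofF m) (P.ofF_comm m) (P.ofF_bijective m) k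

/-- `h^k(G_0(m)) = h^k(F(m+1))`. [folklore] -/
theorem finrank_cohomology_zero_level (m k : ℕ) :
    finrank K (Cohomology (P.dG 0 m) k) = finrank K (Cohomology (d (m + 1)) k) :=
  (P.cohomologyFEquiv m k).finrank_eq.symm

/-- **The comparison map `G_n(m) → Z(m)`** induced by `ev` (which kills `Σ_j im t_j`).
[cite: SerreGAGA1956, n° 16 Lemme 8] -/
def toBase (m k : ℕ) : P.G n m k →ₗ[K] Z m k :=
  (P.flag n m k).liftQ (P.ev m k) (P.flag_eq_ker_ev m k).le

/-- `toBase` on classes. [folklore] -/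
@[simp]
theorem toBase_mk (m k : ℕ) (x : F (m + 1) k) : P.toBase m k (Submodule.Quotient.mk x) = P.ev m k x :=
  rfl

/-- `toBase` is a cochain map. [folklore] -/
theorem toBase_comm (m k : ℕ) (c : P.G n m k) :
    P.toBase m (k + 1) (P.dG n m k c) = dZ m k (P.toBase m k c) := by
  obtain ⟨x, rfl⟩ := Submodule.Quotient.mk_surjective _ c
  rw [dG_mk, toBase_mk, toBase_mk, P.comm_ev]

/-- **`G_n(m) → Z(m)` is bijective in every degree** (two surjections from `F(m+1)` with the same
kernel). [cite: SerreGAGA1956, n° 16 Lemme 8] -/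
theorem toBase_bijective (m k : ℕ) : Bijective (P.toBase m k) := by
  constructor
  · rw [← LinearMap.ker_eq_bot, toBase, Submodule.ker_liftQ, ← P.flag_eq_ker_ev, Submodule.mkQ_map_self]
  · intro z
    obtain ⟨x, rfl⟩ := P.surjective_ev m k z
    exact ⟨Submodule.Quotient.mk x, rfl⟩

/-- **`H^k(G_n(m)) ≃ H^k(Z(m))`**: level `n` computes the cohomology of the skyscraper.
[cite: SerreGAGA1956, n° 16 Lemme 8] -/
noncomputable def cohomologyZEquiv (m k : ℕ) :
    Cohomology (P.dG n m) k ≃ₗ[K] Cohomology (dZ m) k :=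
  Cohomology.equivOfBijective (P.toBase m) (P.toBase_comm m) (P.toBase_bijective m) k

/-- `h^k(G_n(m)) = h^k(Z(m))`. [folklore] -/
theorem finrank_cohomology_top_level (m k : ℕ) :
    finrank K (Cohomology (P.dG n m) k) = finrank K (Cohomology (dZ m) k) :=
  (P.cohomologyZEquiv m k).finrank_eq

/-! ### Finiteness of the levels -/

/-- `H^k(G_0(m))` is finite-dimensional when `H^k(F(m+1))` is. [folklore] -/
theorem finite_zero_level {m k : ℕ} (h : FiniteDimensional K (Cohomology (d (m + 1)) k)) :
    FiniteDimensional K (Cohomology (P.dG 0 m) k) :=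
  LinearEquiv.finiteDimensional (P.cohomologyFEquiv m k)

/-- `H^k(G_n(m))` is finite-dimensional when `H^k(Z(m))` is. [folklore] -/
theorem finite_top_level {m k : ℕ} (h : FiniteDimensional K (Cohomology (dZ m) k)) :
    FiniteDimensional K (Cohomology (P.dG n m) k) :=
  LinearEquiv.finiteDimensional (P.cohomologyZEquiv m k).symm

/-- **Finiteness of a cokernel term**: `H^k(G_{i+1}(m+1))` is finite-dimensional if
`H^k(G_i(m+1))` and `H^{k+1}(G_i(m))` are (exactness of
`H^k(G_i(m+1)) → H^k(G_{i+1}(m+1)) → H^{k+1}(G_i(m))`). [cite: Weibel1994, Thm. 1.3.1] -/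
theorem finite_succ_level (i : ℕ) (hi : i < n) (m k : ℕ)
    (h₁ : FiniteDimensional K (Cohomology (P.dG i (m + 1)) k))
    (h₂ : FiniteDimensional K (Cohomology (P.dG i m) (k + 1))) :
    FiniteDimensional K (Cohomology (P.dG (i + 1) (m + 1)) k) :=
  finiteDimensional_mid_of_exact _ _ ((P.ses i hi m).exact_map_delta k)

/-- **Finiteness of a kernel term, degree `0`**: `H⁰(G_i(m)) ↪ H⁰(G_i(m+1))`.
[cite: Weibel1994, Thm. 1.3.1] -/
theorem finite_of_succ_column_zero (i : ℕ) (hi : i < n) (m : ℕ)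
    (h : FiniteDimensional K (Cohomology (P.dG i (m + 1)) 0)) :
    FiniteDimensional K (Cohomology (P.dG i m) 0) :=
  FiniteDimensional.of_injective _ (P.ses i hi m).injective_map_zero

/-- **Finiteness of a kernel term, degree `k+1`**: exactness of
`H^k(G_{i+1}(m+1)) → H^{k+1}(G_i(m)) → H^{k+1}(G_i(m+1))`. [cite: Weibel1994, Thm. 1.3.1] -/
theorem finite_of_succ_column_succ (i : ℕ) (hi : i < n) (m k : ℕ)
    (h₁ : FiniteDimensional K (Cohomology (P.dG (i + 1) (m + 1)) k))
    (h₂ : FiniteDimensional K (Cohomology (P.dG i (m + 1)) (k + 1))) :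
    FiniteDimensional K (Cohomology (P.dG i m) (k + 1)) :=
  finiteDimensional_mid_of_exact _ _ ((P.ses i hi m).exact_delta_map k)

/-- **Finiteness in the region `m ≥ i`, every degree**: if every `H^k(F(m))` is finite-dimensional,
so is `H^k(G_i(m))` for `i ≤ n` and `m ≥ i` (induction on the level through the cokernel terms).
[cite: SerreGAGA1956, n° 16 Lemme 8] -/
theorem finite_of_le (hF : ∀ m k, FiniteDimensional K (Cohomology (d m) k)) :
    ∀ i, i ≤ n → ∀ m k, i ≤ m → FiniteDimensional K (Cohomology (P.dG i m) k)
  | 0, _, m, k, _ => P.finite_zero_level (hF (m + 1) k)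
  | i + 1, hi, m, k, him => by
    obtain ⟨m, rfl⟩ : ∃ m', m = m' + 1 := ⟨m - 1, by omega⟩
    exact P.finite_succ_level i hi m k (finite_of_le hF i (by omega) (m + 1) k (by omega))
      (finite_of_le hF i (by omega) m (k + 1) (by omega))

/-- **Finiteness of `H⁰` and `H¹` of every level**: if every `H^k(F(m))` and `H⁰(Z(m)), H¹(Z(m))`
are finite-dimensional, so are `H⁰(G_i(m))`, `H¹(G_i(m))` for all `i ≤ n` and all `m` (downward
induction on the level from `G_n ≅ Z` through the kernel terms, inner induction on the distance
`i - m` to the region of `finite_of_le`). [cite: SerreGAGA1956, n° 16 Lemme 8] -/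
theorem finite_deg_le_one (hF : ∀ m k, FiniteDimensional K (Cohomology (d m) k))
    (hZ₀ : ∀ m, FiniteDimensional K (Cohomology (dZ m) 0))
    (hZ₁ : ∀ m, FiniteDimensional K (Cohomology (dZ m) 1)) :
    ∀ r i, i + r = n → ∀ m,
      FiniteDimensional K (Cohomology (P.dG i m) 0) ∧ FiniteDimensional K (Cohomology (P.dG i m) 1)
  | 0, i, h, m => by
    obtain rfl : i = n := by omega
    exact ⟨P.finite_top_level (hZ₀ m), P.finite_top_level (hZ₁ m)⟩
  | r + 1, i, h, m => by
    have hi : i < n := by omega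
    have IH := finite_deg_le_one hF hZ₀ hZ₁ r (i + 1) (by omega)
    suffices H : ∀ g m, i ≤ m + g →
        FiniteDimensional K (Cohomology (P.dG i m) 0) ∧
          FiniteDimensional K (Cohomology (P.dG i m) 1) from H i m (Nat.le_add_left i m)
    intro g
    induction g with
    | zero =>
      intro m hm
      exact ⟨P.finite_of_le hF i hi.le m 0 (by omega), P.finite_of_le hF i hi.le m 1 (by omega)⟩
    | succ g ih =>
      intro m hm
      by_cases h' : i ≤ m + g
      · exact ih m h'
      · obtain ⟨h0, h1⟩ := ih (m + 1) (by omega)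
        exact ⟨P.finite_of_succ_column_zero i hi m h0,
          P.finite_of_succ_column_succ i hi m 0 (IH (m + 1)).1 h1⟩

/-! ### The dimension count -/

section Count

variable (hF : ∀ m k, FiniteDimensional K (Cohomology (d m) k))
  (hZ₀ : ∀ m, FiniteDimensional K (Cohomology (dZ m) 0))
  (hZ₁ : ∀ m, FiniteDimensional K (Cohomology (dZ m) 1))

/-- `h⁰(G_i(m))`. [folklore] -/
noncomputable def hG0 (i m : ℕ) : ℕ :=
  finrank K (Cohomology (P.dG i m) 0)

/-- `h¹(G_i(m))`. [folklore] -/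
noncomputable def hG1 (i m : ℕ) : ℕ :=
  finrank K (Cohomology (P.dG i m) 1)

include hF hZ₀ hZ₁ in
/-- **The six-term inequality of level `i`**:
`h⁰(G_i(m)) + h⁰(G_{i+1}(m+1)) + h¹(G_i(m+1)) ≤ h⁰(G_i(m+1)) + h¹(G_i(m)) + h¹(G_{i+1}(m+1))`
(`ShortExactSeq.finrank_six_term_le` for `ses i m`).
[cite: SerreGAGA1956, n° 16 Lemme 8 (dimension count)] -/
theorem six_term_le (i : ℕ) (hi : i < n) (m : ℕ) :
    P.hG0 i m + P.hG0 (i + 1) (m + 1) + P.hG1 i (m + 1) ≤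
      P.hG0 i (m + 1) + P.hG1 i m + P.hG1 (i + 1) (m + 1) := by
  obtain ⟨_, hA1⟩ := P.finite_deg_le_one hF hZ₀ hZ₁ (n - i) i (by omega) m
  obtain ⟨hB0, hB1⟩ := P.finite_deg_le_one hF hZ₀ hZ₁ (n - i) i (by omega) (m + 1)
  obtain ⟨hC0, hC1⟩ := P.finite_deg_le_one hF hZ₀ hZ₁ (n - (i + 1)) (i + 1) (by omega) (m + 1)
  exact (P.ses i hi m).finrank_six_term_le

/-- The `h⁰`-table of the tower in the format of `exists_pos_h0_of_euler_inequalities`: level `j`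
of the count is the tower level `n - j`. [folklore] -/
noncomputable def tab0 (j m : ℕ) : ℕ :=
  P.hG0 (n - j) m

/-- The `h¹`-table of the tower (same indexing as `tab0`). [folklore] -/
noncomputable def tab1 (j m : ℕ) : ℕ :=
  P.hG1 (n - j) m

include hF hZ₀ hZ₁ in
/-- **The six-term inequalities of the tower** in the format of
`exists_pos_h0_of_euler_inequalities`. [cite: SerreGAGA1956, n° 16 Lemme 8 (dimension count)] -/
theorem tab_step : ∀ j < n, ∀ m,
    P.tab0 (j + 1) m + P.tab0 j (m + 1) + P.tab1 (j + 1) (m + 1) ≤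
      P.tab0 (j + 1) (m + 1) + P.tab1 (j + 1) m + P.tab1 j (m + 1) := by
  intro j hj m
  have h := P.six_term_le hF hZ₀ hZ₁ (n - (j + 1)) (by omega) m
  simp only [tab0, tab1]
  rwa [show n - (j + 1) + 1 = n - j by omega] at h

/-- The base inequality in the format of `exists_pos_h0_of_euler_inequalities` (`G_n ≅ Z`).
[folklore] -/
theorem tab_base (hb : ∀ m, finrank K (Cohomology (dZ m) 1) < finrank K (Cohomology (dZ m) 0)) :
    ∀ m, P.tab1 0 m < P.tab0 0 m := by
  intro m
  simp only [tab0, tab1, hG0, hG1, Nat.sub_zero, finrank_cohomology_top_level]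
  exact hb m

include P hF hZ₀ hZ₁ in
/-- **Serre's dimension count for a flag tower**: if every `H^k(F(m))` and `H⁰(Z(m)), H¹(Z(m))` are
finite-dimensional and `h¹(Z(m)) < h⁰(Z(m))` for all `m` (a non-zero skyscraper has no higher
cohomology), then `H⁰(F(m)) ≠ 0` for some `m ≥ 1` — some positive twist has a non-zero section.
[cite: SerreGAGA1956, n° 16 Lemme 8] [cite: SerreFAC1955, n° 66 Thm. 2 and n° 81 Prop. 6] -/
theorem exists_pos_finrank_cohomology_zero
    (hb : ∀ m, finrank K (Cohomology (dZ m) 1) < finrank K (Cohomology (dZ m) 0)) :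
    ∃ m, 0 < m ∧ 0 < finrank K (Cohomology (d m) 0) := by
  obtain ⟨m, hm⟩ :=
    exists_pos_h0_of_euler_inequalities n P.tab0 P.tab1 (P.tab_step hF hZ₀ hZ₁) (P.tab_base hb)
  refine ⟨m + 1, Nat.succ_pos m, ?_⟩
  simp only [tab0, hG0] at hm
  rwa [Nat.sub_self, finrank_cohomology_zero_level] at hm

include P hF hZ₀ hZ₁ in
/-- **Serre's dimension count for a flag tower, growth form**: under the same hypotheses and
`n ≥ 1`, `h⁰(F(m))`, `m ≥ 1`, is unbounded. [cite: SerreGAGA1956, n° 16 Lemme 8] -/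
theorem exists_lt_finrank_cohomology_zero (hn : 1 ≤ n)
    (hb : ∀ m, finrank K (Cohomology (dZ m) 1) < finrank K (Cohomology (dZ m) 0)) (B : ℕ) :
    ∃ m, 0 < m ∧ B < finrank K (Cohomology (d m) 0) := by
  obtain ⟨m, hm⟩ :=
    exists_lt_h0_of_euler_inequalities hn P.tab0 P.tab1 (P.tab_step hF hZ₀ hZ₁) (P.tab_base hb) B
  refine ⟨m + 1, Nat.succ_pos m, ?_⟩
  simp only [tab0, hG0] at hm
  rwa [Nat.sub_self, finrank_cohomology_zero_level] at hm

end Count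

end FlagTower

end NatCochain

end Literature.Algebra.Homology
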